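import Mathlib
import HarnessLib
import Summits.HubbardSuperconductivity.HubbardSuperconductivity.Theses.ComplexGFFStiffness
import Literature.MathematicalPhysics.StatisticalMechanics.AbkmPackageSlotF4b2

/-!
# Route `ComplexGFFStiffness`, child `L2GaussianCore` of the crux `HypACumulant` — CLOSED

The route child `L2GaussianCore` (item `stmt-HubbardSuperconductivity-27378`, split of the crux
`HypACumulant` by the crux-strategist) is by definition
`Literature.MathematicalPhysics.StatisticalMechanics.GradientRG.L2GaussianCore 4`: for every `d = 4`
[ABKM19] renormalisation-group package, `N`-free sizes `b_TT, φ_TT ≥ 0` for the two `ℓ = 2` slots (F4b2)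
(parallelogram second differences of `q ↦ B_q v`) and (F4Φ22) (of the last-scale functional `q ↦ Φ_q(y)`)
at every height.  It is the `d = 4` instance of `GradientRG.l2GaussianCore` (the second-order Gaussian
fluctuation engine: `GaussianCovarianceComparisonTraceSecond` → `StepMeasureComparisonTraceSecond` →
`FluctuationKernelComparisonSecond{Transfer,Local,Conn,Trace}TorusFRD` → `StepOperatorB{SecondDiff,SecondUnif,
LineSecondDiff,ParaSecondDiff}TorusFRD`, `LastScaleKernel{SecondDiff,LineSecondDiff,ParaSecondDiff}TorusFRD`,
`AbkmPackageSlotF4Phi22`, `AbkmPackageSlotF4b2`).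

Honest scope: this closes ONE child of ONE crux of a rung route (stiffness of a complex Gaussian gradient
field via the [ABKM19] renormalisation group); it does not prove the crux `HypACumulant`, the route, or
anything about superconductivity in the Hubbard model.

## References
* S. Adams, S. Buchholz, R. Kotecký, S. Müller, arXiv:1910.13564, Lemma 8.4 (ℓ = 2), Lemma 12.6
  [AdamsBuchholzKoteckyMuller2019].
* S. Buchholz, J. Funct. Anal. 275 (2018), Thm 4.5 [Buchholz2016].
-/

namespace Summit.HubbardSuperconductivity.HubbardSuperconductivity.Theorems

/-- **The route child `L2GaussianCore` holds**: the `d = 4` instance of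
`GradientRG.l2GaussianCore` (N-free sizes for the `ℓ = 2` slots F4b2 and F4Φ22 of every package).
[cite: AdamsBuchholzKoteckyMuller2019, Lemma 8.4 (ℓ = 2) / Lemma 12.6] -/
theorem L2GaussianCore_proof :
    Summit.HubbardSuperconductivity.HubbardSuperconductivity.Theses.ComplexGFFStiffness.L2GaussianCore := by
  unfold Summit.HubbardSuperconductivity.HubbardSuperconductivity.Theses.ComplexGFFStiffness.L2GaussianCore
  exact Literature.MathematicalPhysics.StatisticalMechanics.GradientRG.l2GaussianCore

end Summit.HubbardSuperconductivity.HubbardSuperconductivity.Theorems
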